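import Literature.NumberTheory.EllipticCurves.TwoDescentOneRoot
import HarnessLib

/-!
# The kernel of the one-root `2`-descent map: explicit halving from a square root of `x − θ` in the
# cubic `2`-division field (Cassels, *Lectures on Elliptic Curves*, §15, Lemma 2)

Topic `NumberTheory/EllipticCurves`; sequel of `TwoDescentOneRoot.lean` (Cassels' map `μ : P ↦ x(P) − θ`,
LMSST 24 §15 Lemma 1). Everything here is PROVED; no named fact, no `sorry`.

Cassels §15 Lemma 2: "The kernel of `μ` is `2𝔊`." For a curve `E/F` whose `2`-division cubic `Ψ₂` is
irreducible over `F` (no rational `2`-torsion), `L = F(θ)` its cubic `2`-division field, this says: if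
`x(P) − θ` is a square in `L` then `P ∈ 2E(F)`. We prove it in an EXPLICIT form that never leaves `F` and `L`
(no splitting field, no Galois cohomology): if `u ∈ L`, `u² = x − θ`, has characteristic polynomial
`U³ − s₁U² + s₂U − s₃` over `F`, then comparing `R(U)R(−U)` (`R` that cubic) with `Ψ₂(x − U²)/4` at `U = u` and
reading coefficients in the basis `1, θ, θ²` gives the SYMMETRIC DATA
`s₁² − 2s₂ = 3x + b₂/4`, `2s₁s₃ − s₂² = −(3x² + (b₂/2)x + b₄/2)`, `s₃² = Ψ₂(x)/4`
(`symmData_of_sq_eq`); and from such data (sign `s₃ = y + (a₁x + a₃)/2`) the `F`-rational point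
`Q = (x + s₂, s₁s₂ − s₃ − (a₁(x + s₂) + a₃)/2)` satisfies `2Q = P` (`exists_add_self_of_symmData`: over a
splitting field `sᵢ` are the elementary symmetric functions of the square roots `uᵢ = √(x − eᵢ)` and `Q` is the
halving point `x(Q) = x + u₁u₂ + u₁u₃ + u₂u₃` of Knapp Thm. 4.2 / the tree's `exists_add_self_eq`, written symmetrically).
Hence **`exists_add_self_of_isSquare_sub_root`**: `x(P) − θ ∈ L*²` ⟹ `P ∈ 2E(F)`, and
**`exists_add_self_of_casselsMap_eq_zero`**: the Cassels map of `TwoDescentOneRoot.lean` kills only `2E(F)`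
among the points with `x(P) ≠ θ` — Cassels' Lemma 2 for the field factor `L` of `F[Θ]`. The two standing
hypotheses on `(L, θ)` — `1, θ, θ²` are `F`-linearly independent, and every element of `L` is a root of a monic
cubic over `F` — hold when `L = F(θ)` is a cubic field (`Ψ₂` irreducible; Cayley–Hamilton); they are kept as
explicit hypotheses so that the file stays elementary.

References:
* [Cassels1991LecturesEllipticCurves] J. W. S. Cassels, *Lectures on Elliptic Curves*, LMSST 24 (1991), §15,
  Lemma 2 (kernel of `μ` is `2𝔊`; proof via `x − Θ = δλ²`, pp. 43–44).
* [Knapp1993] A. W. Knapp, *Elliptic Curves* (1992), Thm. 4.2 (halving criterion and formula).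
* [SilvermanAEC2009] J. H. Silverman, *The Arithmetic of Elliptic Curves*, 2nd ed. (2009), Prop. X.1.4. -/

noncomputable section

namespace WeierstrassCurve.Affine

variable {F : Type*} [Field F] {W : Affine F}

/-! ### Halving from symmetric data (over `F`) -/

section SymmData

variable [CharZero F] {x y s₁ s₂ s₃ : F}

/-- **The symmetric halving point lies on the curve**: if `(x, y) ∈ E(F)` and `s₁, s₂, s₃ ∈ F` satisfy
`s₁² − 2s₂ = 3x + b₂/4`, `2s₁s₃ − s₂² = −(3x² + (b₂/2)x + b₄/2)`, `s₃ = y + (a₁x + a₃)/2`, then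
`Q = (x + s₂, s₁s₂ − s₃ − (a₁(x + s₂) + a₃)/2)` lies on `E` (Knapp's halving point `x(Q) = x + Σ uᵢuⱼ` written in
the elementary symmetric functions of `u₁, u₂, u₃`). [cite: Knapp1993, Thm. 4.2] -/
theorem equation_symmHalving (hE : W.Equation x y) (hS1 : s₁ ^ 2 - 2 * s₂ = 3 * x + W.b₂ / 4)
    (hS2 : 2 * s₁ * s₃ - s₂ ^ 2 = -(3 * x ^ 2 + W.b₂ / 2 * x + W.b₄ / 2))
    (hS3 : s₃ = y + (W.a₁ * x + W.a₃) / 2) :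
    W.Equation (x + s₂) (s₁ * s₂ - s₃ - (W.a₁ * (x + s₂) + W.a₃) / 2) := by
  rw [equation_iff] at hE ⊢
  simp only [b₂, b₄] at hS1 hS2
  linear_combination ((1 / 4 : F) * W.a₁ ^ 2 * x + (1 / 4 : F) * W.a₁ * W.a₃ + (1 / 2 : F) * W.a₁ * x
    * s₁ + (1 : F) * W.a₂ * x + (1 / 2 : F) * W.a₃ * s₁ + (1 / 2 : F) * W.a₄ + (3 / 2 : F) * x ^ 2 +
    (1 : F) * y * s₁ + (1 / 2 : F) * s₂ ^ 2) * hS1 + ((1 / 8 : F) * W.a₁ ^ 2 + (1 / 2 : F) * W.a₂ +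
    (3 / 2 : F) * x + (-1 / 2 : F) * s₁ ^ 2) * hS2 + ((-1 / 4 : F) * W.a₁ ^ 2 * s₁ + (1 / 2 : F) *
    W.a₁ * x + (-1 : F) * W.a₂ * s₁ + (1 / 2 : F) * W.a₃ + (-3 : F) * x * s₁ + (1 : F) * y + (1 : F)
    * s₁ ^ 3 + (-2 : F) * s₁ * s₂ + (1 : F) * s₃) * hS3 + ((1 : F)) * hE

/-- The symmetric data force `s₁s₂ ≠ s₃` on an elliptic curve: `(s₁s₂ − s₃)² · disc(U³ − s₁U² + s₂U − s₃) = Δ/16`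
(over a splitting field `s₁s₂ − s₃ = (u₁ + u₂)(u₁ + u₃)(u₂ + u₃)` and `Δ = 16 ∏ (eᵢ − eⱼ)²`), so `s₁s₂ = s₃` gives
`Δ = 0` (certificate: `Δ` is `−1024 ×` the resultant of the two remaining relations). [cite: Knapp1993, Thm. 4.2] -/
theorem Δ_eq_zero_of_symmData (hE : W.Equation x y) (hS1 : s₁ ^ 2 - 2 * s₂ = 3 * x + W.b₂ / 4)
    (hS2 : 2 * s₁ * s₃ - s₂ ^ 2 = -(3 * x ^ 2 + W.b₂ / 2 * x + W.b₄ / 2))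
    (hS3 : s₃ = y + (W.a₁ * x + W.a₃) / 2) (hw : s₁ * s₂ - s₃ = 0) : W.Δ = 0 := by
  rw [equation_iff] at hE
  simp only [b₂, b₄] at hS1 hS2
  simp only [Δ, b₂, b₄, b₆, b₈]
  linear_combination ((1 / 8 : F) * W.a₁ ^ 7 * x + (1 / 8 : F) * W.a₁ ^ 6 * W.a₃ + (1 / 4 : F) * W.a₁
    ^ 6 * y + (1 / 2 : F) * W.a₁ ^ 6 * s₁ ^ 3 + (1 / 4 : F) * W.a₁ ^ 6 * s₁ * s₂ + (3 / 2 : F) *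
    W.a₁ ^ 5 * W.a₂ * x + (-3 / 2 : F) * W.a₁ ^ 5 * x ^ 2 + (3 / 2 : F) * W.a₁ ^ 5 * x * s₁ ^ 2 + (3
    / 2 : F) * W.a₁ ^ 4 * W.a₂ * W.a₃ + (3 : F) * W.a₁ ^ 4 * W.a₂ * y + (6 : F) * W.a₁ ^ 4 * W.a₂ *
    s₁ ^ 3 + (3 : F) * W.a₁ ^ 4 * W.a₂ * s₁ * s₂ + (-15 / 2 : F) * W.a₁ ^ 4 * W.a₃ * x + (3 / 2 : F)
    * W.a₁ ^ 4 * W.a₃ * s₁ ^ 2 + (-8 : F) * W.a₁ ^ 4 * x ^ 2 * s₁ + (-3 : F) * W.a₁ ^ 4 * x * y +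
    (10 : F) * W.a₁ ^ 4 * x * s₁ ^ 3 + (-3 : F) * W.a₁ ^ 4 * x * s₁ * s₂ + (3 : F) * W.a₁ ^ 4 * y *
    s₁ ^ 2 + (-2 : F) * W.a₁ ^ 4 * s₁ ^ 5 + (3 : F) * W.a₁ ^ 4 * s₁ ^ 3 * s₂ + (6 : F) * W.a₁ ^ 3 *
    W.a₂ ^ 2 * x + (-12 : F) * W.a₁ ^ 3 * W.a₂ * x ^ 2 + (12 : F) * W.a₁ ^ 3 * W.a₂ * x * s₁ ^ 2 +
    (-6 : F) * W.a₁ ^ 3 * W.a₃ ^ 2 + (-16 : F) * W.a₁ ^ 3 * W.a₃ * x * s₁ + (-12 : F) * W.a₁ ^ 3 *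
    W.a₃ * y + (-8 : F) * W.a₁ ^ 3 * W.a₃ * s₁ ^ 3 + (-12 : F) * W.a₁ ^ 3 * W.a₃ * s₁ * s₂ + (-12 :
    F) * W.a₁ ^ 3 * W.a₄ * x + (6 : F) * W.a₁ ^ 2 * W.a₂ ^ 2 * W.a₃ + (12 : F) * W.a₁ ^ 2 * W.a₂ ^ 2
    * y + (24 : F) * W.a₁ ^ 2 * W.a₂ ^ 2 * s₁ ^ 3 + (12 : F) * W.a₁ ^ 2 * W.a₂ ^ 2 * s₁ * s₂ + (-36
    : F) * W.a₁ ^ 2 * W.a₂ * W.a₃ * x + (12 : F) * W.a₁ ^ 2 * W.a₂ * W.a₃ * s₁ ^ 2 + (-64 : F) *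
    W.a₁ ^ 2 * W.a₂ * x ^ 2 * s₁ + (-24 : F) * W.a₁ ^ 2 * W.a₂ * x * y + (80 : F) * W.a₁ ^ 2 * W.a₂
    * x * s₁ ^ 3 + (-24 : F) * W.a₁ ^ 2 * W.a₂ * x * s₁ * s₂ + (24 : F) * W.a₁ ^ 2 * W.a₂ * y * s₁ ^
    2 + (-16 : F) * W.a₁ ^ 2 * W.a₂ * s₁ ^ 5 + (24 : F) * W.a₁ ^ 2 * W.a₂ * s₁ ^ 3 * s₂ + (-8 : F) *
    W.a₁ ^ 2 * W.a₃ ^ 2 * s₁ + (-12 : F) * W.a₁ ^ 2 * W.a₃ * W.a₄ + (36 : F) * W.a₁ ^ 2 * W.a₃ * x ^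
    2 + (-36 : F) * W.a₁ ^ 2 * W.a₃ * x * s₁ ^ 2 + (-32 : F) * W.a₁ ^ 2 * W.a₄ * x * s₁ + (-24 : F)
    * W.a₁ ^ 2 * W.a₄ * y + (-16 : F) * W.a₁ ^ 2 * W.a₄ * s₁ ^ 3 + (-24 : F) * W.a₁ ^ 2 * W.a₄ * s₁
    * s₂ + (96 : F) * W.a₁ ^ 2 * W.a₆ * s₁ + (8 : F) * W.a₁ * W.a₂ ^ 3 * x + (-24 : F) * W.a₁ * W.a₂
    ^ 2 * x ^ 2 + (24 : F) * W.a₁ * W.a₂ ^ 2 * x * s₁ ^ 2 + (-24 : F) * W.a₁ * W.a₂ * W.a₃ ^ 2 +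
    (-64 : F) * W.a₁ * W.a₂ * W.a₃ * x * s₁ + (-48 : F) * W.a₁ * W.a₂ * W.a₃ * y + (-32 : F) * W.a₁
    * W.a₂ * W.a₃ * s₁ ^ 3 + (-48 : F) * W.a₁ * W.a₂ * W.a₃ * s₁ * s₂ + (-48 : F) * W.a₁ * W.a₂ *
    W.a₄ * x + (90 : F) * W.a₁ * W.a₃ ^ 2 * x + (-36 : F) * W.a₁ * W.a₃ ^ 2 * s₁ ^ 2 + (-128 : F) *
    W.a₁ * W.a₃ * W.a₄ * s₁ + (192 : F) * W.a₁ * W.a₃ * x ^ 2 * s₁ + (72 : F) * W.a₁ * W.a₃ * x * y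
    + (-240 : F) * W.a₁ * W.a₃ * x * s₁ ^ 3 + (72 : F) * W.a₁ * W.a₃ * x * s₁ * s₂ + (-72 : F) *
    W.a₁ * W.a₃ * y * s₁ ^ 2 + (48 : F) * W.a₁ * W.a₃ * s₁ ^ 5 + (-72 : F) * W.a₁ * W.a₃ * s₁ ^ 3 *
    s₂ + (72 : F) * W.a₁ * W.a₄ * x ^ 2 + (-72 : F) * W.a₁ * W.a₄ * x * s₁ ^ 2 + (216 : F) * W.a₁ *
    W.a₆ * x + (8 : F) * W.a₂ ^ 3 * W.a₃ + (16 : F) * W.a₂ ^ 3 * y + (32 : F) * W.a₂ ^ 3 * s₁ ^ 3 +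
    (16 : F) * W.a₂ ^ 3 * s₁ * s₂ + (-24 : F) * W.a₂ ^ 2 * W.a₃ * x + (24 : F) * W.a₂ ^ 2 * W.a₃ *
    s₁ ^ 2 + (-128 : F) * W.a₂ ^ 2 * x ^ 2 * s₁ + (-48 : F) * W.a₂ ^ 2 * x * y + (160 : F) * W.a₂ ^
    2 * x * s₁ ^ 3 + (-48 : F) * W.a₂ ^ 2 * x * s₁ * s₂ + (48 : F) * W.a₂ ^ 2 * y * s₁ ^ 2 + (-32 :
    F) * W.a₂ ^ 2 * s₁ ^ 5 + (48 : F) * W.a₂ ^ 2 * s₁ ^ 3 * s₂ + (96 : F) * W.a₂ * W.a₃ ^ 2 * s₁ +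
    (-48 : F) * W.a₂ * W.a₃ * W.a₄ + (-128 : F) * W.a₂ * W.a₄ * x * s₁ + (-96 : F) * W.a₂ * W.a₄ * y
    + (-64 : F) * W.a₂ * W.a₄ * s₁ ^ 3 + (-96 : F) * W.a₂ * W.a₄ * s₁ * s₂ + (384 : F) * W.a₂ * W.a₆
    * s₁ + (54 : F) * W.a₃ ^ 3 + (288 : F) * W.a₃ ^ 2 * x * s₁ + (108 : F) * W.a₃ ^ 2 * y + (-72 :
    F) * W.a₃ ^ 2 * s₁ ^ 3 + (108 : F) * W.a₃ ^ 2 * s₁ * s₂ + (72 : F) * W.a₃ * W.a₄ * x + (-72 : F)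
    * W.a₃ * W.a₄ * s₁ ^ 2 + (216 : F) * W.a₃ * W.a₆ + (-128 : F) * W.a₄ ^ 2 * s₁ + (384 : F) * W.a₄
    * x ^ 2 * s₁ + (144 : F) * W.a₄ * x * y + (-480 : F) * W.a₄ * x * s₁ ^ 3 + (144 : F) * W.a₄ * x
    * s₁ * s₂ + (-144 : F) * W.a₄ * y * s₁ ^ 2 + (96 : F) * W.a₄ * s₁ ^ 5 + (-144 : F) * W.a₄ * s₁ ^
    3 * s₂ + (1152 : F) * W.a₆ * x * s₁ + (432 : F) * W.a₆ * y + (-288 : F) * W.a₆ * s₁ ^ 3 + (432 :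
    F) * W.a₆ * s₁ * s₂) * hw + ((-1 / 4 : F) * W.a₁ ^ 6 * x ^ 2 + (1 / 2 : F) * W.a₁ ^ 6 * x * s₁ ^
    2 + (-1 / 2 : F) * W.a₁ ^ 5 * W.a₃ * x + (1 / 2 : F) * W.a₁ ^ 5 * W.a₃ * s₁ ^ 2 + (-3 : F) *
    W.a₁ ^ 4 * W.a₂ * x ^ 2 + (6 : F) * W.a₁ ^ 4 * W.a₂ * x * s₁ ^ 2 + (-1 / 4 : F) * W.a₁ ^ 4 *
    W.a₃ ^ 2 + (-1 : F) * W.a₁ ^ 4 * W.a₄ * x + (1 : F) * W.a₁ ^ 4 * W.a₄ * s₁ ^ 2 + (3 : F) * W.a₁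
    ^ 4 * W.a₆ + (-3 : F) * W.a₁ ^ 4 * x ^ 3 + (3 : F) * W.a₁ ^ 4 * x ^ 2 * s₁ ^ 2 + (2 : F) * W.a₁
    ^ 4 * x ^ 2 * s₂ + (-4 : F) * W.a₁ ^ 4 * x * s₁ ^ 2 * s₂ + (2 : F) * W.a₁ ^ 4 * s₁ ^ 4 * s₂ +
    (-4 : F) * W.a₁ ^ 3 * W.a₂ * W.a₃ * x + (4 : F) * W.a₁ ^ 3 * W.a₂ * W.a₃ * s₁ ^ 2 + (-4 : F) *
    W.a₁ ^ 3 * W.a₃ * W.a₄ + (-12 : F) * W.a₁ ^ 3 * W.a₃ * x * s₁ ^ 2 + (4 : F) * W.a₁ ^ 3 * W.a₃ *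
    x * s₂ + (-4 : F) * W.a₁ ^ 3 * W.a₃ * s₁ ^ 2 * s₂ + (-12 : F) * W.a₁ ^ 2 * W.a₂ ^ 2 * x ^ 2 +
    (24 : F) * W.a₁ ^ 2 * W.a₂ ^ 2 * x * s₁ ^ 2 + (2 : F) * W.a₁ ^ 2 * W.a₂ * W.a₃ ^ 2 + (-8 : F) *
    W.a₁ ^ 2 * W.a₂ * W.a₄ * x + (8 : F) * W.a₁ ^ 2 * W.a₂ * W.a₄ * s₁ ^ 2 + (24 : F) * W.a₁ ^ 2 *
    W.a₂ * W.a₆ + (-24 : F) * W.a₁ ^ 2 * W.a₂ * x ^ 3 + (24 : F) * W.a₁ ^ 2 * W.a₂ * x ^ 2 * s₁ ^ 2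
    + (16 : F) * W.a₁ ^ 2 * W.a₂ * x ^ 2 * s₂ + (-32 : F) * W.a₁ ^ 2 * W.a₂ * x * s₁ ^ 2 * s₂ + (16
    : F) * W.a₁ ^ 2 * W.a₂ * s₁ ^ 4 * s₂ + (6 : F) * W.a₁ ^ 2 * W.a₃ ^ 2 * x + (-12 : F) * W.a₁ ^ 2
    * W.a₃ ^ 2 * s₁ ^ 2 + (2 : F) * W.a₁ ^ 2 * W.a₃ ^ 2 * s₂ + (-4 : F) * W.a₁ ^ 2 * W.a₄ ^ 2 + (-24
    : F) * W.a₁ ^ 2 * W.a₄ * x * s₁ ^ 2 + (8 : F) * W.a₁ ^ 2 * W.a₄ * x * s₂ + (-8 : F) * W.a₁ ^ 2 *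
    W.a₄ * s₁ ^ 2 * s₂ + (72 : F) * W.a₁ ^ 2 * W.a₆ * x + (-24 : F) * W.a₁ ^ 2 * W.a₆ * s₂ + (-8 :
    F) * W.a₁ * W.a₂ ^ 2 * W.a₃ * x + (8 : F) * W.a₁ * W.a₂ ^ 2 * W.a₃ * s₁ ^ 2 + (-16 : F) * W.a₁ *
    W.a₂ * W.a₃ * W.a₄ + (-48 : F) * W.a₁ * W.a₂ * W.a₃ * x * s₁ ^ 2 + (16 : F) * W.a₁ * W.a₂ * W.a₃
    * x * s₂ + (-16 : F) * W.a₁ * W.a₂ * W.a₃ * s₁ ^ 2 * s₂ + (-48 : F) * W.a₁ * W.a₃ * W.a₄ * x +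
    (-48 : F) * W.a₁ * W.a₃ * W.a₄ * s₁ ^ 2 + (32 : F) * W.a₁ * W.a₃ * W.a₄ * s₂ + (72 : F) * W.a₁ *
    W.a₃ * x ^ 3 + (-72 : F) * W.a₁ * W.a₃ * x ^ 2 * s₁ ^ 2 + (-48 : F) * W.a₁ * W.a₃ * x ^ 2 * s₂ +
    (96 : F) * W.a₁ * W.a₃ * x * s₁ ^ 2 * s₂ + (-48 : F) * W.a₁ * W.a₃ * s₁ ^ 4 * s₂ + (-16 : F) *
    W.a₂ ^ 3 * x ^ 2 + (32 : F) * W.a₂ ^ 3 * x * s₁ ^ 2 + (12 : F) * W.a₂ ^ 2 * W.a₃ ^ 2 + (-16 : F)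
    * W.a₂ ^ 2 * W.a₄ * x + (16 : F) * W.a₂ ^ 2 * W.a₄ * s₁ ^ 2 + (48 : F) * W.a₂ ^ 2 * W.a₆ + (-48
    : F) * W.a₂ ^ 2 * x ^ 3 + (48 : F) * W.a₂ ^ 2 * x ^ 2 * s₁ ^ 2 + (32 : F) * W.a₂ ^ 2 * x ^ 2 *
    s₂ + (-64 : F) * W.a₂ ^ 2 * x * s₁ ^ 2 * s₂ + (32 : F) * W.a₂ ^ 2 * s₁ ^ 4 * s₂ + (72 : F) *
    W.a₂ * W.a₃ ^ 2 * x + (-24 : F) * W.a₂ * W.a₃ ^ 2 * s₂ + (-16 : F) * W.a₂ * W.a₄ ^ 2 + (-96 : F)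
    * W.a₂ * W.a₄ * x * s₁ ^ 2 + (32 : F) * W.a₂ * W.a₄ * x * s₂ + (-32 : F) * W.a₂ * W.a₄ * s₁ ^ 2
    * s₂ + (288 : F) * W.a₂ * W.a₆ * x + (-96 : F) * W.a₂ * W.a₆ * s₂ + (108 : F) * W.a₃ ^ 2 * x ^ 2
    + (-72 : F) * W.a₃ ^ 2 * x * s₂ + (72 : F) * W.a₃ ^ 2 * s₁ ^ 2 * s₂ + (-48 : F) * W.a₄ ^ 2 * x +
    (-48 : F) * W.a₄ ^ 2 * s₁ ^ 2 + (32 : F) * W.a₄ ^ 2 * s₂ + (144 : F) * W.a₄ * x ^ 3 + (-144 : F)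
    * W.a₄ * x ^ 2 * s₁ ^ 2 + (-96 : F) * W.a₄ * x ^ 2 * s₂ + (192 : F) * W.a₄ * x * s₁ ^ 2 * s₂ +
    (-96 : F) * W.a₄ * s₁ ^ 4 * s₂ + (432 : F) * W.a₆ * x ^ 2 + (-288 : F) * W.a₆ * x * s₂ + (288 :
    F) * W.a₆ * s₁ ^ 2 * s₂) * hS1 + ((1 / 4 : F) * W.a₁ ^ 6 * s₁ ^ 2 + (3 : F) * W.a₁ ^ 4 * W.a₂ *
    s₁ ^ 2 + (-4 : F) * W.a₁ ^ 4 * x ^ 2 + (5 : F) * W.a₁ ^ 4 * x * s₁ ^ 2 + (-1 : F) * W.a₁ ^ 4 *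
    s₁ ^ 4 + (-8 : F) * W.a₁ ^ 3 * W.a₃ * x + (-4 : F) * W.a₁ ^ 3 * W.a₃ * s₁ ^ 2 + (12 : F) * W.a₁
    ^ 2 * W.a₂ ^ 2 * s₁ ^ 2 + (-32 : F) * W.a₁ ^ 2 * W.a₂ * x ^ 2 + (40 : F) * W.a₁ ^ 2 * W.a₂ * x *
    s₁ ^ 2 + (-8 : F) * W.a₁ ^ 2 * W.a₂ * s₁ ^ 4 + (-4 : F) * W.a₁ ^ 2 * W.a₃ ^ 2 + (-16 : F) * W.a₁
    ^ 2 * W.a₄ * x + (-8 : F) * W.a₁ ^ 2 * W.a₄ * s₁ ^ 2 + (48 : F) * W.a₁ ^ 2 * W.a₆ + (-32 : F) *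
    W.a₁ * W.a₂ * W.a₃ * x + (-16 : F) * W.a₁ * W.a₂ * W.a₃ * s₁ ^ 2 + (-64 : F) * W.a₁ * W.a₃ *
    W.a₄ + (96 : F) * W.a₁ * W.a₃ * x ^ 2 + (-120 : F) * W.a₁ * W.a₃ * x * s₁ ^ 2 + (24 : F) * W.a₁
    * W.a₃ * s₁ ^ 4 + (16 : F) * W.a₂ ^ 3 * s₁ ^ 2 + (-64 : F) * W.a₂ ^ 2 * x ^ 2 + (80 : F) * W.a₂
    ^ 2 * x * s₁ ^ 2 + (-16 : F) * W.a₂ ^ 2 * s₁ ^ 4 + (48 : F) * W.a₂ * W.a₃ ^ 2 + (-64 : F) * W.a₂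
    * W.a₄ * x + (-32 : F) * W.a₂ * W.a₄ * s₁ ^ 2 + (192 : F) * W.a₂ * W.a₆ + (144 : F) * W.a₃ ^ 2 *
    x + (-36 : F) * W.a₃ ^ 2 * s₁ ^ 2 + (-64 : F) * W.a₄ ^ 2 + (192 : F) * W.a₄ * x ^ 2 + (-240 : F)
    * W.a₄ * x * s₁ ^ 2 + (48 : F) * W.a₄ * s₁ ^ 4 + (576 : F) * W.a₆ * x + (-144 : F) * W.a₆ * s₁ ^
    2) * hS2 + ((1 / 8 : F) * W.a₁ ^ 7 * x + (1 / 8 : F) * W.a₁ ^ 6 * W.a₃ + (1 / 4 : F) * W.a₁ ^ 6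
    * y + (1 / 4 : F) * W.a₁ ^ 6 * s₁ * s₂ + (3 / 2 : F) * W.a₁ ^ 5 * W.a₂ * x + (-3 / 2 : F) * W.a₁
    ^ 5 * x ^ 2 + (3 / 2 : F) * W.a₁ ^ 5 * x * s₁ ^ 2 + (3 / 2 : F) * W.a₁ ^ 4 * W.a₂ * W.a₃ + (3 :
    F) * W.a₁ ^ 4 * W.a₂ * y + (3 : F) * W.a₁ ^ 4 * W.a₂ * s₁ * s₂ + (-15 / 2 : F) * W.a₁ ^ 4 * W.a₃
    * x + (3 / 2 : F) * W.a₁ ^ 4 * W.a₃ * s₁ ^ 2 + (-3 : F) * W.a₁ ^ 4 * x * y + (-3 : F) * W.a₁ ^ 4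
    * x * s₁ * s₂ + (3 : F) * W.a₁ ^ 4 * y * s₁ ^ 2 + (3 : F) * W.a₁ ^ 4 * s₁ ^ 3 * s₂ + (6 : F) *
    W.a₁ ^ 3 * W.a₂ ^ 2 * x + (-12 : F) * W.a₁ ^ 3 * W.a₂ * x ^ 2 + (12 : F) * W.a₁ ^ 3 * W.a₂ * x *
    s₁ ^ 2 + (-6 : F) * W.a₁ ^ 3 * W.a₃ ^ 2 + (-12 : F) * W.a₁ ^ 3 * W.a₃ * y + (-12 : F) * W.a₁ ^ 3
    * W.a₃ * s₁ * s₂ + (-12 : F) * W.a₁ ^ 3 * W.a₄ * x + (6 : F) * W.a₁ ^ 2 * W.a₂ ^ 2 * W.a₃ + (12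
    : F) * W.a₁ ^ 2 * W.a₂ ^ 2 * y + (12 : F) * W.a₁ ^ 2 * W.a₂ ^ 2 * s₁ * s₂ + (-36 : F) * W.a₁ ^ 2
    * W.a₂ * W.a₃ * x + (12 : F) * W.a₁ ^ 2 * W.a₂ * W.a₃ * s₁ ^ 2 + (-24 : F) * W.a₁ ^ 2 * W.a₂ * x
    * y + (-24 : F) * W.a₁ ^ 2 * W.a₂ * x * s₁ * s₂ + (24 : F) * W.a₁ ^ 2 * W.a₂ * y * s₁ ^ 2 + (24
    : F) * W.a₁ ^ 2 * W.a₂ * s₁ ^ 3 * s₂ + (-12 : F) * W.a₁ ^ 2 * W.a₃ * W.a₄ + (36 : F) * W.a₁ ^ 2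
    * W.a₃ * x ^ 2 + (-36 : F) * W.a₁ ^ 2 * W.a₃ * x * s₁ ^ 2 + (-24 : F) * W.a₁ ^ 2 * W.a₄ * y +
    (-24 : F) * W.a₁ ^ 2 * W.a₄ * s₁ * s₂ + (8 : F) * W.a₁ * W.a₂ ^ 3 * x + (-24 : F) * W.a₁ * W.a₂
    ^ 2 * x ^ 2 + (24 : F) * W.a₁ * W.a₂ ^ 2 * x * s₁ ^ 2 + (-24 : F) * W.a₁ * W.a₂ * W.a₃ ^ 2 +
    (-48 : F) * W.a₁ * W.a₂ * W.a₃ * y + (-48 : F) * W.a₁ * W.a₂ * W.a₃ * s₁ * s₂ + (-48 : F) * W.a₁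
    * W.a₂ * W.a₄ * x + (90 : F) * W.a₁ * W.a₃ ^ 2 * x + (-36 : F) * W.a₁ * W.a₃ ^ 2 * s₁ ^ 2 + (72
    : F) * W.a₁ * W.a₃ * x * y + (72 : F) * W.a₁ * W.a₃ * x * s₁ * s₂ + (-72 : F) * W.a₁ * W.a₃ * y
    * s₁ ^ 2 + (-72 : F) * W.a₁ * W.a₃ * s₁ ^ 3 * s₂ + (72 : F) * W.a₁ * W.a₄ * x ^ 2 + (-72 : F) *
    W.a₁ * W.a₄ * x * s₁ ^ 2 + (216 : F) * W.a₁ * W.a₆ * x + (8 : F) * W.a₂ ^ 3 * W.a₃ + (16 : F) *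
    W.a₂ ^ 3 * y + (16 : F) * W.a₂ ^ 3 * s₁ * s₂ + (-24 : F) * W.a₂ ^ 2 * W.a₃ * x + (24 : F) * W.a₂
    ^ 2 * W.a₃ * s₁ ^ 2 + (-48 : F) * W.a₂ ^ 2 * x * y + (-48 : F) * W.a₂ ^ 2 * x * s₁ * s₂ + (48 :
    F) * W.a₂ ^ 2 * y * s₁ ^ 2 + (48 : F) * W.a₂ ^ 2 * s₁ ^ 3 * s₂ + (-48 : F) * W.a₂ * W.a₃ * W.a₄
    + (-96 : F) * W.a₂ * W.a₄ * y + (-96 : F) * W.a₂ * W.a₄ * s₁ * s₂ + (54 : F) * W.a₃ ^ 3 + (108 :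
    F) * W.a₃ ^ 2 * y + (108 : F) * W.a₃ ^ 2 * s₁ * s₂ + (72 : F) * W.a₃ * W.a₄ * x + (-72 : F) *
    W.a₃ * W.a₄ * s₁ ^ 2 + (216 : F) * W.a₃ * W.a₆ + (144 : F) * W.a₄ * x * y + (144 : F) * W.a₄ * x
    * s₁ * s₂ + (-144 : F) * W.a₄ * y * s₁ ^ 2 + (-144 : F) * W.a₄ * s₁ ^ 3 * s₂ + (432 : F) * W.a₆
    * y + (432 : F) * W.a₆ * s₁ * s₂) * hS3 + ((1 / 4 : F) * W.a₁ ^ 6 + (3 : F) * W.a₁ ^ 4 * W.a₂ +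
    (-3 : F) * W.a₁ ^ 4 * x + (3 : F) * W.a₁ ^ 4 * s₁ ^ 2 + (-12 : F) * W.a₁ ^ 3 * W.a₃ + (12 : F) *
    W.a₁ ^ 2 * W.a₂ ^ 2 + (-24 : F) * W.a₁ ^ 2 * W.a₂ * x + (24 : F) * W.a₁ ^ 2 * W.a₂ * s₁ ^ 2 +
    (-24 : F) * W.a₁ ^ 2 * W.a₄ + (-48 : F) * W.a₁ * W.a₂ * W.a₃ + (72 : F) * W.a₁ * W.a₃ * x + (-72
    : F) * W.a₁ * W.a₃ * s₁ ^ 2 + (16 : F) * W.a₂ ^ 3 + (-48 : F) * W.a₂ ^ 2 * x + (48 : F) * W.a₂ ^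
    2 * s₁ ^ 2 + (-96 : F) * W.a₂ * W.a₄ + (108 : F) * W.a₃ ^ 2 + (144 : F) * W.a₄ * x + (-144 : F)
    * W.a₄ * s₁ ^ 2 + (432 : F) * W.a₆) * hE

variable [DecidableEq F] [W.IsElliptic]

/-- **Halving from symmetric data** (the explicit, `F`-rational form of Cassels §15 Lemma 2 / Knapp Thm. 4.2):
with `(x, y) ∈ E(F)` and `s₁, s₂, s₃` as in `equation_symmHalving`, the point
`Q = (x + s₂, s₁s₂ − s₃ − (a₁(x + s₂) + a₃)/2) ∈ E(F)` satisfies `Q + Q = (x, y)`.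
[cite: Cassels1991LecturesEllipticCurves, §15 Lemma 2] -/
theorem exists_add_self_of_symmData (hP : W.Nonsingular x y) (hS1 : s₁ ^ 2 - 2 * s₂ = 3 * x + W.b₂ / 4)
    (hS2 : 2 * s₁ * s₃ - s₂ ^ 2 = -(3 * x ^ 2 + W.b₂ / 2 * x + W.b₄ / 2))
    (hS3 : s₃ = y + (W.a₁ * x + W.a₃) / 2) :
    ∃ hQ : W.Nonsingular (x + s₂) (s₁ * s₂ - s₃ - (W.a₁ * (x + s₂) + W.a₃) / 2),
      Point.some _ _ hQ + Point.some _ _ hQ = Point.some x y hP := by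
  have hQe := equation_symmHalving hP.1 hS1 hS2 hS3
  have hQn : W.Nonsingular _ _ := equation_iff_nonsingular.mp hQe
  have hw : s₁ * s₂ - s₃ ≠ 0 := fun hw ↦ W.Δ'.ne_zero (by
    rw [coe_Δ']; exact Δ_eq_zero_of_symmData hP.1 hS1 hS2 hS3 hw)
  have hE := hP.1
  rw [equation_iff] at hE
  simp only [b₂, b₄] at hS1 hS2
  set x₁ := x + s₂ with hx₁
  set y₁ := s₁ * s₂ - s₃ - (W.a₁ * (x + s₂) + W.a₃) / 2 with hy₁
  have hy : y₁ ≠ W.negY x₁ y₁ := by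
    intro hyy
    apply hw
    rw [negY, hy₁, hx₁] at hyy
    linear_combination (1 / 2 : F) * hyy
  have hD : y₁ - W.negY x₁ y₁ ≠ 0 := sub_ne_zero.mpr hy
  refine ⟨hQn, ?_⟩
  rw [Point.add_self_of_Y_ne hy]
  have hX : W.addX x₁ x₁ (W.slope x₁ x₁ y₁ y₁) = x := by
    have key : (y₁ - W.negY x₁ y₁) ^ 2 * W.addX x₁ x₁
        ((3 * x₁ ^ 2 + 2 * W.a₂ * x₁ + W.a₄ - W.a₁ * y₁) / (y₁ - W.negY x₁ y₁)) =
        (3 * x₁ ^ 2 + 2 * W.a₂ * x₁ + W.a₄ - W.a₁ * y₁) ^ 2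
          + W.a₁ * (3 * x₁ ^ 2 + 2 * W.a₂ * x₁ + W.a₄ - W.a₁ * y₁) * (y₁ - W.negY x₁ y₁)
          - (W.a₂ + x₁ + x₁) * (y₁ - W.negY x₁ y₁) ^ 2 := by
      simp only [addX]
      field_simp
      ring
    rw [slope_of_Y_ne rfl hy]
    refine mul_left_cancel₀ (pow_ne_zero 2 hD) ?_
    rw [key, negY, hy₁, hx₁]
    linear_combination ((-1 / 32 : F) * W.a₁ ^ 4 * x + (-1 / 32 : F) * W.a₁ ^ 3 * W.a₃ + (-1 / 16 : F) *
    W.a₁ ^ 3 * x * s₁ + (-1 / 4 : F) * W.a₁ ^ 2 * W.a₂ * x + (-1 / 16 : F) * W.a₁ ^ 2 * W.a₃ * s₁ +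
    (-1 / 16 : F) * W.a₁ ^ 2 * W.a₄ + (7 / 16 : F) * W.a₁ ^ 2 * x ^ 2 + (-7 / 8 : F) * W.a₁ ^ 2 * x
    * s₁ ^ 2 + (-7 / 4 : F) * W.a₁ ^ 2 * x * s₂ + (-1 / 8 : F) * W.a₁ ^ 2 * y * s₁ + (-15 / 16 : F)
    * W.a₁ ^ 2 * s₂ ^ 2 + (-1 / 8 : F) * W.a₁ * W.a₂ * W.a₃ + (-1 / 4 : F) * W.a₁ * W.a₂ * x * s₁ +
    (13 / 8 : F) * W.a₁ * W.a₃ * x + (-7 / 8 : F) * W.a₁ * W.a₃ * s₁ ^ 2 + (-7 / 4 : F) * W.a₁ *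
    W.a₃ * s₂ + (-3 / 4 : F) * W.a₁ * x ^ 2 * s₁ + (4 : F) * W.a₁ * x * y + (-7 / 4 : F) * W.a₁ * x
    * s₁ ^ 3 + (-7 / 2 : F) * W.a₁ * x * s₁ * s₂ + (-1 / 2 : F) * W.a₂ ^ 2 * x + (-1 / 4 : F) * W.a₂
    * W.a₃ * s₁ + (-1 / 4 : F) * W.a₂ * W.a₄ + (-9 / 4 : F) * W.a₂ * x ^ 2 + (-7 / 2 : F) * W.a₂ * x
    * s₁ ^ 2 + (-7 : F) * W.a₂ * x * s₂ + (-1 / 2 : F) * W.a₂ * y * s₁ + (-15 / 4 : F) * W.a₂ * s₂ ^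
    2 + (1 : F) * W.a₃ ^ 2 + (-3 / 4 : F) * W.a₃ * x * s₁ + (4 : F) * W.a₃ * y + (-7 / 4 : F) * W.a₃
    * s₁ ^ 3 + (-7 / 2 : F) * W.a₃ * s₁ * s₂ + (-3 / 4 : F) * W.a₄ * x + (-7 / 4 : F) * W.a₄ * s₁ ^
    2 + (-7 / 2 : F) * W.a₄ * s₂ + (-9 / 4 : F) * x ^ 3 + (-21 / 4 : F) * x ^ 2 * s₁ ^ 2 + (-21 / 2
    : F) * x ^ 2 * s₂ + (-3 / 2 : F) * x * y * s₁ + (-45 / 4 : F) * x * s₂ ^ 2 + (4 : F) * y ^ 2 +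
    (-7 / 2 : F) * y * s₁ ^ 3 + (-7 : F) * y * s₁ * s₂ + (7 / 4 : F) * s₁ ^ 2 * s₂ ^ 2 + (-9 / 2 :
    F) * s₂ ^ 3) * hS1 + ((-1 / 64 : F) * W.a₁ ^ 4 + (-1 / 8 : F) * W.a₁ ^ 2 * W.a₂ + (1 / 8 : F) *
    W.a₁ ^ 2 * x + (-3 / 8 : F) * W.a₁ ^ 2 * s₁ ^ 2 + (1 / 2 : F) * W.a₁ * W.a₃ + (-1 : F) * W.a₁ *
    x * s₁ + (-1 / 4 : F) * W.a₂ ^ 2 + (1 / 2 : F) * W.a₂ * x + (-3 / 2 : F) * W.a₂ * s₁ ^ 2 + (-1 :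
    F) * W.a₃ * s₁ + (1 : F) * W.a₄ + (3 / 4 : F) * x ^ 2 + (-9 / 2 : F) * x * s₁ ^ 2 + (-2 : F) * y
    * s₁ + (7 / 4 : F) * s₁ ^ 4) * hS2 + ((1 / 32 : F) * W.a₁ ^ 4 * s₁ + (-1 / 2 : F) * W.a₁ ^ 3 * x
    + (1 / 4 : F) * W.a₁ ^ 2 * W.a₂ * s₁ + (-1 / 2 : F) * W.a₁ ^ 2 * W.a₃ + (-1 / 4 : F) * W.a₁ ^ 2
    * x * s₁ + (-1 : F) * W.a₁ ^ 2 * y + (3 / 4 : F) * W.a₁ ^ 2 * s₁ ^ 3 + (2 : F) * W.a₁ ^ 2 * s₁ *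
    s₂ + (-1 : F) * W.a₁ ^ 2 * s₃ + (-2 : F) * W.a₁ * W.a₂ * x + (-1 : F) * W.a₁ * W.a₃ * s₁ + (-6 :
    F) * W.a₁ * x ^ 2 + (2 : F) * W.a₁ * x * s₁ ^ 2 + (-4 : F) * W.a₁ * x * s₂ + (1 / 2 : F) * W.a₂
    ^ 2 * s₁ + (-2 : F) * W.a₂ * W.a₃ + (-1 : F) * W.a₂ * x * s₁ + (-4 : F) * W.a₂ * y + (3 : F) *
    W.a₂ * s₁ ^ 3 + (8 : F) * W.a₂ * s₁ * s₂ + (-4 : F) * W.a₂ * s₃ + (-6 : F) * W.a₃ * x + (2 : F)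
    * W.a₃ * s₁ ^ 2 + (-4 : F) * W.a₃ * s₂ + (-2 : F) * W.a₄ * s₁ + (-3 / 2 : F) * x ^ 2 * s₁ + (-12
    : F) * x * y + (9 : F) * x * s₁ ^ 3 + (24 : F) * x * s₁ * s₂ + (-12 : F) * x * s₃ + (4 : F) * y
    * s₁ ^ 2 + (-8 : F) * y * s₂ + (-7 / 2 : F) * s₁ ^ 5 + (16 : F) * s₁ * s₂ ^ 2 + (-8 : F) * s₂ *
    s₃) * hS3
  have hY : W.addY x₁ x₁ y₁ (W.slope x₁ x₁ y₁ y₁) = y := by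
    rw [addY, negAddY, negY, hX, slope_of_Y_ne rfl hy]
    have hl := div_mul_cancel₀ (3 * x₁ ^ 2 + 2 * W.a₂ * x₁ + W.a₄ - W.a₁ * y₁) hD
    set l := (3 * x₁ ^ 2 + 2 * W.a₂ * x₁ + W.a₄ - W.a₁ * y₁) / (y₁ - W.negY x₁ y₁)
    refine mul_left_cancel₀ hD ?_
    rw [negY] at hl ⊢
    rw [hy₁, hx₁] at hl ⊢
    linear_combination ((-1 / 4 : F) * W.a₁ ^ 2 * x + (-1 / 4 : F) * W.a₁ * W.a₃ + (-1 / 2 : F) * W.a₁ *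
    x * s₁ + (-1 : F) * W.a₂ * x + (-1 / 2 : F) * W.a₃ * s₁ + (-1 / 2 : F) * W.a₄ + (-3 / 2 : F) * x
    ^ 2 + (-1 : F) * y * s₁ + (-3 / 2 : F) * s₂ ^ 2) * hS1 + ((-1 / 8 : F) * W.a₁ ^ 2 + (-1 / 2 : F)
    * W.a₂ + (-3 / 2 : F) * x + (1 / 2 : F) * s₁ ^ 2) * hS2 + ((1 / 4 : F) * W.a₁ ^ 2 * s₁ + (1 : F)
    * W.a₂ * s₁ + (3 : F) * x * s₁ + (-1 : F) * s₁ ^ 3 + (4 : F) * s₁ * s₂ + (-2 : F) * s₃) * hS3 +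
    s₂ * hl
  simp only [Point.some.injEq]
  exact ⟨hX, hY⟩

end SymmData

/-! ### Symmetric data from a square root of `x − θ` in the cubic field -/

section Root

variable [CharZero F] {L : Type*} [Field L] [CharZero L] [Algebra F L] {θ u : L} {x y s₁ s₂ s₃ : F}

/-- **Reading `u² = x − θ` in the basis `1, θ, θ²`.** Let `θ ∈ L` be a root of the `2`-division cubic of `W/F`
with `1, θ, θ²` linearly independent over `F`, and `u ∈ L` with `u² = x − θ` a root of `U³ − s₁U² + s₂U − s₃`
(`sᵢ ∈ F`). Then `s₁² − 2s₂ = 3x + b₂/4`, `2s₁s₃ − s₂² = −(3x² + (b₂/2)x + b₄/2)` and `4s₃² = Ψ₂(x)`: with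
`R(U) = U³ − s₁U² + s₂U − s₃`, `R(U)R(−U) − Ψ₂(x − U²)/4 = c₄U⁴ + c₂U² + c₀` vanishes at `U = u`, i.e.
`c₄(x − θ)² + c₂(x − θ) + c₀ = 0`, and the `cᵢ ∈ F` vanish by independence (Cassels §15: `Norm(x − Θ) = F(x)`
and the proof of Lemma 2). [cite: Cassels1991LecturesEllipticCurves, §15 Lemma 2] -/
theorem symmData_of_sq_eq (hθ : (W.baseChange L).toAffine.IsTwoTorsionX θ)
    (hind : ∀ p q r : F, algebraMap F L p + algebraMap F L q * θ + algebraMap F L r * θ ^ 2 = 0 →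
      p = 0 ∧ q = 0 ∧ r = 0)
    (hu : u ^ 2 = algebraMap F L x - θ)
    (hR : u ^ 3 - algebraMap F L s₁ * u ^ 2 + algebraMap F L s₂ * u - algebraMap F L s₃ = 0) :
    s₁ ^ 2 - 2 * s₂ = 3 * x + W.b₂ / 4 ∧
      2 * s₁ * s₃ - s₂ ^ 2 = -(3 * x ^ 2 + W.b₂ / 2 * x + W.b₄ / 2) ∧
      4 * s₃ ^ 2 = 4 * x ^ 3 + W.b₂ * x ^ 2 + 2 * W.b₄ * x + W.b₆ := by
  have hb2 : (W.baseChange L).toAffine.b₂ = algebraMap F L W.b₂ := W.map_b₂ (algebraMap F L)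
  have hb4 : (W.baseChange L).toAffine.b₄ = algebraMap F L W.b₄ := W.map_b₄ (algebraMap F L)
  have hb6 : (W.baseChange L).toAffine.b₆ = algebraMap F L W.b₆ := W.map_b₆ (algebraMap F L)
  have hΨ := hθ.eq
  rw [hb2, hb4, hb6] at hΨ
  -- the three coefficients, in `F`
  set c₄ := s₁ ^ 2 - 2 * s₂ - 3 * x - W.b₂ / 4 with hc₄
  set c₂ := 2 * s₁ * s₃ - s₂ ^ 2 + 3 * x ^ 2 + W.b₂ / 2 * x + W.b₄ / 2 with hc₂
  set c₀ := s₃ ^ 2 - (4 * x ^ 3 + W.b₂ * x ^ 2 + 2 * W.b₄ * x + W.b₆) / 4 with hc₀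
  have key : algebraMap F L (c₄ * x ^ 2 + c₂ * x + c₀) + algebraMap F L (-2 * c₄ * x - c₂) * θ +
      algebraMap F L c₄ * θ ^ 2 = 0 := by
    simp only [hc₄, hc₂, hc₀, map_add, map_sub, map_mul, map_pow, map_neg, map_div₀, map_ofNat]
    linear_combination ((-1 : L) * u ^ 3 + (-1 : L) * u ^ 2 * (algebraMap F L s₁) + (-1 : L) * u *
    (algebraMap F L s₂) + (-1 : L) * (algebraMap F L s₃)) * hR + ((1 : L) * u ^ 4 + (-1 : L) * u ^ 2
    * θ + (1 : L) * u ^ 2 * (algebraMap F L x) + (-1 : L) * u ^ 2 * (algebraMap F L s₁) ^ 2 + (2 :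
    L) * u ^ 2 * (algebraMap F L s₂) + (1 : L) * θ ^ 2 + (-2 : L) * θ * (algebraMap F L x) + (1 : L)
    * θ * (algebraMap F L s₁) ^ 2 + (-2 : L) * θ * (algebraMap F L s₂) + (1 : L) * (algebraMap F L
    x) ^ 2 + (-1 : L) * (algebraMap F L x) * (algebraMap F L s₁) ^ 2 + (2 : L) * (algebraMap F L x)
    * (algebraMap F L s₂) + (-2 : L) * (algebraMap F L s₁) * (algebraMap F L s₃) + (1 : L) *
    (algebraMap F L s₂) ^ 2) * hu + (-1 / 4 : L) * hΨ
  obtain ⟨h0, h1, h4⟩ := hind _ _ _ key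
  have hc4 : c₄ = 0 := h4
  have hc2 : c₂ = 0 := by linear_combination (-1 : F) * h1 - 2 * x * hc4
  have hc0 : c₀ = 0 := by linear_combination h0 - x ^ 2 * hc4 - x * hc2
  refine ⟨?_, ?_, ?_⟩
  · linear_combination hc4
  · linear_combination hc2
  · linear_combination (4 : F) * hc0

variable [DecidableEq F] [W.IsElliptic]

/-- **Cassels §15 Lemma 2, explicit form: a square root of `x(P) − θ` in the cubic field halves `P` over `F`.**
Let `θ ∈ L ⊇ F` be a root of the `2`-division cubic of the elliptic curve `W/F` with `1, θ, θ²` independent over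
`F` (e.g. `L = F(θ)`, `Ψ₂` irreducible), `P = (x, y) ∈ E(F)`, and `u ∈ L` with `u² = x − θ` satisfying a monic cubic
`U³ − s₁U² + s₂U − s₃` over `F` (its characteristic polynomial when `[L : F] = 3`). Then `P = Q + Q` for some
`Q ∈ E(F)` — namely `Q = (x + s₂, ±(s₁s₂ − s₃) − …)` with the sign of `(s₁, s₃)` fixed by `s₃ = y + (a₁x + a₃)/2`.
[cite: Cassels1991LecturesEllipticCurves, §15 Lemma 2] -/
theorem exists_add_self_of_sq_eq (hθ : (W.baseChange L).toAffine.IsTwoTorsionX θ)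
    (hind : ∀ p q r : F, algebraMap F L p + algebraMap F L q * θ + algebraMap F L r * θ ^ 2 = 0 →
      p = 0 ∧ q = 0 ∧ r = 0)
    (hP : W.Nonsingular x y) (hu : u ^ 2 = algebraMap F L x - θ)
    (hR : u ^ 3 - algebraMap F L s₁ * u ^ 2 + algebraMap F L s₂ * u - algebraMap F L s₃ = 0) :
    ∃ Q : W.Point, Q + Q = Point.some x y hP := by
  obtain ⟨hS1, hS2, hS3sq⟩ := symmData_of_sq_eq hθ hind hu hR
  have hsq : s₃ ^ 2 = (y + (W.a₁ * x + W.a₃) / 2) ^ 2 := by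
    have h := twoDivision_eval_eq_sq_of_equation hP.1
    linear_combination (1 / 4 : F) * hS3sq + (1 / 4 : F) * h
  rcases sq_eq_sq_iff_eq_or_eq_neg.mp hsq with hS3 | hS3
  · obtain ⟨hQ, e⟩ := exists_add_self_of_symmData hP hS1 hS2 hS3
    exact ⟨_, e⟩
  · have hS1' : (-s₁) ^ 2 - 2 * s₂ = 3 * x + W.b₂ / 4 := by linear_combination hS1
    have hS2' : 2 * (-s₁) * (-s₃) - s₂ ^ 2 = -(3 * x ^ 2 + W.b₂ / 2 * x + W.b₄ / 2) := by
      linear_combination hS2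
    have hS3' : -s₃ = y + (W.a₁ * x + W.a₃) / 2 := by linear_combination (-1 : F) * hS3
    obtain ⟨hQ, e⟩ := exists_add_self_of_symmData hP hS1' hS2' hS3'
    exact ⟨_, e⟩

/-- **`x(P) − θ` a square in the cubic field `⟹ P ∈ 2E(F)`** (Cassels §15 Lemma 2 for the field factor `L = F(θ)`
of `F[Θ]`), assuming every element of `L` is a root of a monic cubic over `F` (Cayley–Hamilton for `[L : F] = 3`)
and `1, θ, θ²` independent. [cite: Cassels1991LecturesEllipticCurves, §15 Lemma 2] -/
theorem exists_add_self_of_isSquare_sub_root (hθ : (W.baseChange L).toAffine.IsTwoTorsionX θ)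
    (hind : ∀ p q r : F, algebraMap F L p + algebraMap F L q * θ + algebraMap F L r * θ ^ 2 = 0 →
      p = 0 ∧ q = 0 ∧ r = 0)
    (hcub : ∀ v : L, ∃ s₁ s₂ s₃ : F,
      v ^ 3 - algebraMap F L s₁ * v ^ 2 + algebraMap F L s₂ * v - algebraMap F L s₃ = 0)
    (hP : W.Nonsingular x y) (hsq : IsSquare (algebraMap F L x - θ)) :
    ∃ Q : W.Point, Q + Q = Point.some x y hP := by
  obtain ⟨u, hu⟩ := hsq
  obtain ⟨s₁, s₂, s₃, hR⟩ := hcub u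
  exact exists_add_self_of_sq_eq hθ hind hP (by rw [hu, pow_two]) hR

variable (L) in
/-- **The Cassels map kills only `2E(F)`** (Cassels §15 Lemma 2): for `P = (x, y) ∈ E(F)` with `x ≠ θ` in `L`
(automatic when `θ ∉ F`), `casselsMap L hθ P = 0` (i.e. `x − θ ∈ Lˣ²`) implies `P ∈ 2E(F)`; with
`casselsMap_two_nsmul` the kernel of the Cassels map is exactly `2E(F)` under the standing hypotheses on
`(L, θ)`. [cite: Cassels1991LecturesEllipticCurves, §15 Lemma 2] -/
theorem exists_add_self_of_casselsMap_eq_zero [DecidableEq L] [(W.baseChange L).IsElliptic]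
    (hθ : (W.baseChange L).toAffine.IsTwoTorsionX θ)
    (hind : ∀ p q r : F, algebraMap F L p + algebraMap F L q * θ + algebraMap F L r * θ ^ 2 = 0 →
      p = 0 ∧ q = 0 ∧ r = 0)
    (hcub : ∀ v : L, ∃ s₁ s₂ s₃ : F,
      v ^ 3 - algebraMap F L s₁ * v ^ 2 + algebraMap F L s₂ * v - algebraMap F L s₃ = 0)
    (hP : W.Nonsingular x y) (hx : algebraMap F L x ≠ θ)
    (h0 : Point.casselsMap L hθ (Point.some x y hP) = 0) :
    ∃ Q : W.Point, Q + Q = Point.some x y hP := by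
  refine exists_add_self_of_isSquare_sub_root hθ hind hcub hP ?_
  rw [Point.casselsMap_some L hθ hP hx, ofMul_eq_zero, sqClass_eq_one_iff (sub_ne_zero.mpr hx)] at h0
  obtain ⟨w, hw⟩ := h0
  exact ⟨w, by rw [hw, pow_two]⟩

end Root

end WeierstrassCurve.Affine

end
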